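import Literature.NumberTheory.LFunctions.WeilMellinInversion
import Literature.NumberTheory.LFunctions.RiemannXiLogDeriv
import Literature.NumberTheory.LFunctions.RiemannSiegelFacts
import Mathlib.MeasureTheory.Integral.IntegralEqImproper
import HarnessLib

/-!
# The right edge of the explicit-formula contour: `(1/2π) ∫ (ξ'/ξ)(3/2+iy) k̂(3/2+iy) dy = W(g)`

Sibling of `WeilExplicit.lean`, `WeilMellinInversion.lean`, `RiemannXiLogDeriv.lean`. In the
contour-integral proof of the Guinand–Weil explicit formula (E. Bombieri, Rend. Lincei (9) 11
(2000), §2) one integrates `(ξ'/ξ)(s) ĝ(s)` over the boundary of `[−1/2, 3/2] × [−T, T]`; the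
functional equation folds the left edge onto the right one, where the weight becomes
`k̂(s) = ĝ(s) + ĝ(1 − s)`, the transform of the symmetrised test function `k(t) = g(t) + g(−t)`
(`weilSymm`, `weilMellin_weilSymm`). This file evaluates the resulting absolutely convergent
line integral term by term from `ξ'/ξ(s) = 1/s + 1/(s−1) − (log π)/2 + ½ψ(s/2) − Σ Λ(n)n^{-s}`
(`logDeriv_riemannXi_eq_of_one_lt_re`):

* polar terms `∫ (1/s + 1/(s−1)) k̂ = 2π (ĝ(0) + ĝ(1))` (`integral_polar_mul_weilMellin_weilSymm`,
  Bombieri (2.3));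
* `∫ (−(log π)/2) k̂ = −2π g(0) log π`;
* prime terms `∫ (Σ Λ(n) n^{-s}) k̂ = 2π Σ Λ(n) n^{-1/2}(g(log n) + g(−log n))`
  (`integral_LSeries_mul_weilMellin_weilSymm`, Bombieri (2.2); the interchange by absolute
  convergence);
* the Gamma term: `∫ ½ψ(s/2) k̂(s) dy` is moved from `Re s = 3/2` to `Re s = 1/2` (Cauchy's theorem
  on `[1/2, 3/2] × [−T, T]`, the horizontal sides being `O(log T/T²)`), where
  `½(ψ(w) + ψ(w̄)) = Re ψ(w)` turns it into `∫ ĝ(1/2+it) Re ψ(1/4+it/2) dt = weilArchIntegral g`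
  (`integral_digamma_mul_weilMellin_weilSymm`);

whence **`integral_logDeriv_riemannXi_mul_weilMellin_weilSymm`**:
`∫ (ξ'/ξ)(3/2+iy) k̂(3/2+iy) dy = 2π · weilFunctional g`, together with the integrability of the
integrand (`integrable_logDeriv_riemannXi_mul_weilMellin`) and the decay
`|ĝ(s)| ≤ C/(1 + (Im s)²)³` on vertical strips (`norm_weilMellin_le_cube`) used for the horizontal
sides of the main contour.

Everything here is proved; there are no named facts.

## References

* E. Bombieri, *Remarks on Weil's quadratic functional in the theory of prime numbers I*, Rend.
  Mat. Acc. Lincei (9) 11 (2000), 183–233, §2, (2.2)–(2.4).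
* H. Iwaniec, E. Kowalski, *Analytic Number Theory*, AMS Coll. Publ. 53 (2004), Thm. 5.12.
-/

noncomputable section

open Complex Filter Set MeasureTheory LSeries
open scoped Real Topology ComplexConjugate LSeries.notation ArithmeticFunction.vonMangoldt

namespace Literature.NumberTheory.LFunctions

variable {g : ℝ → ℂ}

/-! ### Higher decay of `ĝ` on vertical strips -/

/-- The constant of the decay `|ĝ(s)| ≤ C/(1+(Im s)²)²` on `|Re s − 1/2| ≤ A`. [folklore] -/
def weilDecayW2 (A : ℝ) (g : ℝ → ℂ) : ℝ :=
  weilDecayW A g + weilDecayW A (deriv (deriv g))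

/-- `weilDecayW2 A g ≥ 0`. [folklore] -/
theorem weilDecayW2_nonneg (A : ℝ) (g : ℝ → ℂ) : 0 ≤ weilDecayW2 A g :=
  add_nonneg (weilDecayW_nonneg _ _) (weilDecayW_nonneg _ _)

/-- **`|ĝ(s)| ≤ C/(1 + (Im s)²)²` on `|Re s − 1/2| ≤ A`** (four integrations by parts).
[folklore] -/
theorem norm_weilMellin_le_sq (hg : IsWeilTest g) {A : ℝ} {s : ℂ} (hs : |s.re - 1 / 2| ≤ A) :
    ‖weilMellin g s‖ ≤ weilDecayW2 A g / (1 + s.im ^ 2) ^ 2 := by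
  have hpos : 0 < 1 + s.im ^ 2 := by positivity
  rw [le_div_iff₀ (by positivity)]
  have h1 := norm_weilMellin_le_of_abs_re_le hg hs
  have h2 := norm_weilMellin_le_of_abs_re_le hg.deriv.deriv hs
  rw [weilMellin_deriv_deriv hg, norm_mul, norm_pow] at h2
  rw [le_div_iff₀ hpos] at h1 h2
  have h3 : s.im ^ 2 ≤ ‖s - 1 / 2‖ ^ 2 := by
    have : |s.im| ≤ ‖s - 1 / 2‖ := by simpa using Complex.abs_im_le_norm (s - 1 / 2)
    nlinarith [abs_nonneg s.im, sq_abs s.im]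
  have h4 : 0 ≤ ‖weilMellin g s‖ := norm_nonneg _
  have h5 : s.im ^ 2 * ‖weilMellin g s‖ * (1 + s.im ^ 2) ≤ weilDecayW A (deriv (deriv g)) := by
    have h := mul_le_mul_of_nonneg_right h3 (mul_nonneg h4 hpos.le)
    calc s.im ^ 2 * ‖weilMellin g s‖ * (1 + s.im ^ 2)
        = s.im ^ 2 * (‖weilMellin g s‖ * (1 + s.im ^ 2)) := by ring
      _ ≤ ‖s - 1 / 2‖ ^ 2 * (‖weilMellin g s‖ * (1 + s.im ^ 2)) := h
      _ = ‖s - 1 / 2‖ ^ 2 * ‖weilMellin g s‖ * (1 + s.im ^ 2) := by ring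
      _ ≤ weilDecayW A (deriv (deriv g)) := h2
  unfold weilDecayW2
  nlinarith

/-- The constant of the decay `|ĝ(s)| ≤ C/(1+(Im s)²)³` on `|Re s − 1/2| ≤ A`. [folklore] -/
def weilDecayW3 (A : ℝ) (g : ℝ → ℂ) : ℝ :=
  weilDecayW2 A g + weilDecayW2 A (deriv (deriv g))

/-- `weilDecayW3 A g ≥ 0`. [folklore] -/
theorem weilDecayW3_nonneg (A : ℝ) (g : ℝ → ℂ) : 0 ≤ weilDecayW3 A g :=
  add_nonneg (weilDecayW2_nonneg _ _) (weilDecayW2_nonneg _ _)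

/-- **`|ĝ(s)| ≤ C/(1 + (Im s)²)³` on `|Re s − 1/2| ≤ A`** (six integrations by parts; Bombieri §2:
"`f̃` is rapidly decreasing on vertical lines"). [cite: Bombieri2000Weil, §2] -/
theorem norm_weilMellin_le_cube (hg : IsWeilTest g) {A : ℝ} {s : ℂ} (hs : |s.re - 1 / 2| ≤ A) :
    ‖weilMellin g s‖ ≤ weilDecayW3 A g / (1 + s.im ^ 2) ^ 3 := by
  have hpos : 0 < 1 + s.im ^ 2 := by positivity
  rw [le_div_iff₀ (by positivity)]
  have h1 := norm_weilMellin_le_sq hg hs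
  have h2 := norm_weilMellin_le_sq hg.deriv.deriv hs
  rw [weilMellin_deriv_deriv hg, norm_mul, norm_pow] at h2
  rw [le_div_iff₀ (by positivity)] at h1 h2
  have h3 : s.im ^ 2 ≤ ‖s - 1 / 2‖ ^ 2 := by
    have : |s.im| ≤ ‖s - 1 / 2‖ := by simpa using Complex.abs_im_le_norm (s - 1 / 2)
    nlinarith [abs_nonneg s.im, sq_abs s.im]
  have h4 : 0 ≤ ‖weilMellin g s‖ := norm_nonneg _
  have h5 : s.im ^ 2 * ‖weilMellin g s‖ * (1 + s.im ^ 2) ^ 2 ≤ weilDecayW2 A (deriv (deriv g)) := by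
    have h := mul_le_mul_of_nonneg_right h3 (mul_nonneg h4 (pow_nonneg hpos.le 2))
    calc s.im ^ 2 * ‖weilMellin g s‖ * (1 + s.im ^ 2) ^ 2
        = s.im ^ 2 * (‖weilMellin g s‖ * (1 + s.im ^ 2) ^ 2) := by ring
      _ ≤ ‖s - 1 / 2‖ ^ 2 * (‖weilMellin g s‖ * (1 + s.im ^ 2) ^ 2) := h
      _ = ‖s - 1 / 2‖ ^ 2 * ‖weilMellin g s‖ * (1 + s.im ^ 2) ^ 2 := by ring
      _ ≤ weilDecayW2 A (deriv (deriv g)) := h2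
  unfold weilDecayW3
  nlinarith [pow_nonneg hpos.le 2]

/-! ### The symmetrised test function `k(t) = g(t) + g(−t)` -/

/-- `k(t) = g(t) + g(−t)`: the test function whose transform `k̂ = ĝ + ĝ(1 − ·)` weights the
right edge once the left edge has been folded over (Bombieri §2). [cite: Bombieri2000Weil, §2] -/
def weilSymm (g : ℝ → ℂ) : ℝ → ℂ :=
  fun t ↦ g t + g (-t)

/-- `weilSymm g = g + g ∘ (−·)`. [folklore] -/
theorem weilSymm_eq (g : ℝ → ℂ) : weilSymm g = g + fun t ↦ g (-t) := rfl

/-- `k` is a test function. [folklore] -/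
theorem IsWeilTest.weilSymm (hg : IsWeilTest g) : IsWeilTest (weilSymm g) := by
  rw [weilSymm_eq]; exact hg.add hg.comp_neg

/-- `k̂(s) = ĝ(s) + ĝ(1 − s)`. [cite: Bombieri2000Weil, §2] -/
theorem weilMellin_weilSymm (hg : IsWeilTest g) (s : ℂ) :
    weilMellin (weilSymm g) s = weilMellin g s + weilMellin g (1 - s) := by
  rw [weilSymm_eq, weilMellin_add hg.1.continuous hg.2 hg.comp_neg.1.continuous hg.comp_neg.2,
    weilMellin_comp_neg]

/-- `k(0) = 2 g(0)`. [folklore] -/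
theorem weilSymm_zero (g : ℝ → ℂ) : weilSymm g 0 = 2 * g 0 := by
  simp [weilSymm]; ring

/-! ### Integrability against `k̂` on a vertical line -/

/-- `log(1 + |y|) ≤ |y|`. [folklore] -/
theorem log_one_add_abs_le (y : ℝ) : Real.log (1 + |y|) ≤ |y| := by
  have := Real.log_le_sub_one_of_pos (by positivity : 0 < 1 + |y|)
  linarith

/-- **Integrability on a vertical line against a factor of logarithmic growth**: if
`‖F(y)‖ ≤ C + log(1+|y|)` and `F` is continuous then `y ↦ F(y) ĥ(c + iy)` is integrable for every
test function `h` (decay `|ĥ| ≤ D/(1+y²)²`). [folklore] -/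
theorem integrable_mul_weilMellin_vertical_of_norm_le_log {h : ℝ → ℂ} (hh : IsWeilTest h) (c : ℝ)
    {F : ℝ → ℂ} (hF : Continuous F) {C : ℝ} (hC : ∀ y, ‖F y‖ ≤ C + Real.log (1 + |y|)) :
    Integrable fun y : ℝ ↦ F y * weilMellin h (c + y * I) := by
  set D := weilDecayW2 |c - 1 / 2| h with hD
  have hD0 : 0 ≤ D := weilDecayW2_nonneg _ _
  refine Integrable.mono' (integrable_inv_one_add_sq.const_mul (2 * (|C| + 1) * D))
    (hF.mul (continuous_weilMellin_vertical hh.1.continuous hh.2 c)).aestronglyMeasurable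
    (Eventually.of_forall fun y ↦ ?_)
  have hk : ‖weilMellin h (c + y * I)‖ ≤ D / (1 + y ^ 2) ^ 2 := by
    have := norm_weilMellin_le_sq hh (A := |c - 1 / 2|) (s := c + y * I) (by simp)
    simpa [hD] using this
  have hFy : ‖F y‖ ≤ (|C| + 1) * (1 + |y|) := by
    have h1 := hC y
    have h2 := log_one_add_abs_le y
    nlinarith [le_abs_self C, abs_nonneg C, abs_nonneg y]
  have hy2 : 1 + |y| ≤ 2 * (1 + y ^ 2) := by
    rcases le_or_gt |y| 1 with h | h
    · nlinarith [sq_nonneg y]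
    · have : |y| ≤ |y| ^ 2 := by nlinarith
      rw [sq_abs] at this; linarith
  have hpos : 0 < 1 + y ^ 2 := by positivity
  rw [norm_mul]
  calc ‖F y‖ * ‖weilMellin h (c + y * I)‖
      ≤ (|C| + 1) * (1 + |y|) * (D / (1 + y ^ 2) ^ 2) :=
        mul_le_mul hFy hk (norm_nonneg _) (by positivity)
    _ ≤ (|C| + 1) * (2 * (1 + y ^ 2)) * (D / (1 + y ^ 2) ^ 2) := by gcongr
    _ = 2 * (|C| + 1) * D * (1 + y ^ 2)⁻¹ := by field_simp

/-- Integrability of `y ↦ ĥ(c + iy)/(c + iy − a)` for `Re a ≠ c`. [folklore] -/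
theorem integrable_weilMellin_vertical_div_sub {h : ℝ → ℂ} (hh : IsWeilTest h) {c : ℝ} {a : ℂ}
    (hac : a.re ≠ c) :
    Integrable fun y : ℝ ↦ weilMellin h (c + y * I) / (c + y * I - a) := by
  have hne : ∀ y : ℝ, (c : ℂ) + y * I - a ≠ 0 := fun y h0 ↦ by
    have := congrArg Complex.re h0
    simp at this
    exact hac (by linarith)
  have hcont : Continuous fun y : ℝ ↦ ((c : ℂ) + y * I - a)⁻¹ :=
    Continuous.inv₀ (by fun_prop) hne
  have hbd : ∀ y : ℝ, ‖((c : ℂ) + y * I - a)⁻¹‖ ≤ |c - a.re|⁻¹ := by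
    intro y
    rw [norm_inv]
    refine inv_anti₀ (abs_pos.2 (sub_ne_zero.2 (Ne.symm hac))) ?_
    have := Complex.abs_re_le_norm ((c : ℂ) + y * I - a)
    simpa using this
  simpa [div_eq_mul_inv] using integrable_weilMellin_vertical_mul hh c hcont hbd

/-! ### The polar terms -/

/-- **Polar terms** (Bombieri (2.3), both poles read on the line `Re s = 3/2` after the fold):
`∫ (1/s + 1/(s−1)) k̂(s) dy = 2π (ĝ(0) + ĝ(1))`, `s = 3/2 + iy`. [cite: Bombieri2000Weil, §2 eq. (2.3)] -/
theorem integral_polar_mul_weilMellin_weilSymm (hg : IsWeilTest g) :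
    ∫ y : ℝ, (1 / (((3 / 2 : ℝ) : ℂ) + y * I) + 1 / (((3 / 2 : ℝ) : ℂ) + y * I - 1)) *
        weilMellin (weilSymm g) (((3 / 2 : ℝ) : ℂ) + y * I) = 2 * π * weilPolarTerm g := by
  have hk : IsWeilTest (weilSymm g) := hg.weilSymm
  set c : ℝ := 3 / 2 with hc
  have h0 := integral_weilMellin_vertical_div_sub hk (c := c) (a := 0) (by norm_num [hc])
  have h1 := integral_weilMellin_vertical_div_sub hk (c := c) (a := 1) (by norm_num [hc])
  have i0 := integrable_weilMellin_vertical_div_sub hk (c := c) (a := 0) (by norm_num [hc])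
  have i1 := integrable_weilMellin_vertical_div_sub hk (c := c) (a := 1) (by norm_num [hc])
  have e : (fun y : ℝ ↦ (1 / ((c : ℂ) + y * I) + 1 / ((c : ℂ) + y * I - 1)) *
      weilMellin (weilSymm g) (c + y * I)) = fun y : ℝ ↦
        weilMellin (weilSymm g) (c + y * I) / (c + y * I - 0) +
        weilMellin (weilSymm g) (c + y * I) / (c + y * I - 1) := by
    funext y; rw [sub_zero]; ring
  rw [e, integral_add i0 i1, h0, h1, ← mul_add, weilPolarTerm,
    ← integral_Ioi_add_comp_neg_mul_polarWeight hg]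
  congr 1
  have hgc : Continuous g := hg.1.continuous
  have hkc : Continuous (weilSymm g) := hk.1.continuous
  have j0 : Integrable (fun x : ℝ ↦ weilSymm g x * cexp ((0 - 1 / 2) * x)) (volume.restrict (Ioi 0)) :=
    ((hkc.mul (by fun_prop)).integrable_of_hasCompactSupport hk.2.mul_right).integrableOn
  have j1 : Integrable (fun x : ℝ ↦ weilSymm g x * cexp ((1 - 1 / 2) * x)) (volume.restrict (Ioi 0)) :=
    ((hkc.mul (by fun_prop)).integrable_of_hasCompactSupport hk.2.mul_right).integrableOn
  rw [← integral_add j0 j1]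
  refine setIntegral_congr_fun measurableSet_Ioi fun x _ ↦ ?_
  simp only [weilSymm]
  have e1 : ((0 : ℂ) - 1 / 2) * x = -(x : ℂ) / 2 := by ring
  have e2 : ((1 : ℂ) - 1 / 2) * x = (x : ℂ) / 2 := by ring
  rw [e1, e2]
  ring

/-! ### The `log π` term -/

/-- **The `log π` term** (Bombieri (2.2) with `n = 1`): `∫ a · k̂(3/2 + iy) dy = a · 2π · 2g(0)`.
[cite: Bombieri2000Weil, §2 eq. (2.2)] -/
theorem integral_const_mul_weilMellin_weilSymm (hg : IsWeilTest g) (a : ℂ) (c : ℝ) :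
    ∫ y : ℝ, a * weilMellin (weilSymm g) (c + y * I) = a * (2 * π * (2 * g 0)) := by
  rw [integral_const_mul, integral_weilMellin_vertical hg.weilSymm c, weilSymm_zero]

/-! ### The prime terms -/

/-- `y ↦ n^{-(c+iy)}`-type factors: `term Λ (c + iy) n` is continuous in `y`. [folklore] -/
theorem continuous_term_vertical (f : ℕ → ℂ) (c : ℝ) (n : ℕ) :
    Continuous fun y : ℝ ↦ term f (c + y * I) n := by
  rcases eq_or_ne n 0 with rfl | hn
  · simp only [term_zero]; exact continuous_const
  · simp only [term_of_ne_zero hn]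
    exact continuous_const.div (continuous_const.cpow (by fun_prop) fun _ ↦
      natCast_mem_slitPlane.2 hn) fun y ↦ cpow_ne_zero_iff.2 (Or.inl (Nat.cast_ne_zero.2 hn))

/-- `‖term f (c + iy) n‖ = ‖term f c n‖`. [folklore] -/
theorem norm_term_vertical (f : ℕ → ℂ) (c y : ℝ) (n : ℕ) :
    ‖term f (c + y * I) n‖ = ‖term f (c : ℂ) n‖ := by
  rw [norm_term_eq, norm_term_eq]
  simp

/-- **The prime terms** (Bombieri (2.2): `(1/2πi)∫ f̃(s) n^{-s} ds = f(n)`, summed against `Λ`):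
`∫ (Σₙ Λ(n) n^{-s}) k̂(s) dy = 2π Σₙ Λ(n) n^{-1/2} (g(log n) + g(−log n))`, `s = 3/2 + iy`, the
interchange being justified by `Σ Λ(n) n^{-3/2} ∫ |k̂| < ∞`. [cite: Bombieri2000Weil, §2 eq. (2.2)] -/
theorem integral_LSeries_mul_weilMellin_weilSymm (hg : IsWeilTest g) :
    ∫ y : ℝ, L ↗Λ (((3 / 2 : ℝ) : ℂ) + y * I) * weilMellin (weilSymm g) (((3 / 2 : ℝ) : ℂ) + y * I) =
      2 * π * weilPrimeTerm g := by
  have hk : IsWeilTest (weilSymm g) := hg.weilSymm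
  set c : ℝ := 3 / 2 with hc
  set k := weilSymm g with hk_def
  -- the summands
  set F : ℕ → ℝ → ℂ := fun n y ↦ weilMellin k (c + y * I) * term ↗Λ (c + y * I) n with hF
  have hFint : ∀ n, Integrable (F n) := fun n ↦
    integrable_weilMellin_vertical_mul hk c (continuous_term_vertical _ c n)
      (B := ‖term ↗Λ (c : ℂ) n‖) fun y ↦ (norm_term_vertical _ c y n).le
  have hnorm : ∀ n, (∫ y : ℝ, ‖F n y‖) = (∫ y : ℝ, ‖weilMellin k (c + y * I)‖) * ‖term ↗Λ (c : ℂ) n‖ := by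
    intro n
    rw [← integral_mul_const]
    congr 1 with y
    rw [hF, norm_mul, norm_term_vertical]
  have hsum : Summable fun n ↦ ∫ y : ℝ, ‖F n y‖ := by
    simp_rw [hnorm]
    refine Summable.mul_left _ ?_
    have h := ArithmeticFunction.LSeriesSummable_vonMangoldt (s := (c : ℂ)) (by simp [hc]; norm_num)
    exact summable_norm_iff.mpr h
  have hswap := integral_tsum_of_summable_integral_norm hFint hsum
  -- each summand integrates to `2π Λ(n) n^{-1/2} k(log n)`
  have hterm : ∀ n : ℕ, (∫ y : ℝ, F n y) =
      2 * π * (((Λ n : ℝ) : ℂ) / (Real.sqrt n : ℂ) * (g (Real.log n) + g (-Real.log n))) := by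
    intro n
    rcases eq_or_ne n 0 with rfl | hn
    · simp [hF, term_zero]
    have e : F n = fun y : ℝ ↦ ((Λ n : ℝ) : ℂ) *
        (weilMellin k (c + y * I) * (n : ℂ) ^ (-((c : ℂ) + y * I))) := by
      funext y
      simp only [hF, term_of_ne_zero hn, cpow_neg, div_eq_mul_inv]
      ring
    rw [e, integral_const_mul, integral_weilMellin_vertical_mul_natCast_cpow hk c hn]
    simp only [hk_def, weilSymm]
    ring
  calc ∫ y : ℝ, L ↗Λ ((c : ℂ) + y * I) * weilMellin k (c + y * I)
      = ∫ y : ℝ, ∑' n : ℕ, F n y := by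
        congr 1 with y
        rw [hF, LSeries, mul_comm, ← tsum_mul_left]
    _ = ∑' n : ℕ, ∫ y : ℝ, F n y := hswap.symm
    _ = ∑' n : ℕ, 2 * π * (((Λ n : ℝ) : ℂ) / (Real.sqrt n : ℂ) * (g (Real.log n) + g (-Real.log n))) :=
        tsum_congr hterm
    _ = 2 * π * weilPrimeTerm g := by rw [tsum_mul_left, weilPrimeTerm]

/-! ### The Gamma term: shifting `∫ ½ψ(s/2) k̂(s)` from `Re s = 3/2` to `Re s = 1/2` -/

/-- Cauchy's theorem for a rectangle `[a,b] × [c,d]` with real corners, in the four-term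
convention (bottom − top + i·right − i·left). [folklore] -/
theorem integral_boundary_rect_eq_zero' (f : ℂ → ℂ) {a b c d : ℝ}
    (H : DifferentiableOn ℂ f (uIcc a b ×ℂ uIcc c d)) :
    (∫ x : ℝ in a..b, f (x + c * I)) - (∫ x : ℝ in a..b, f (x + d * I)) +
      I * (∫ y : ℝ in c..d, f (b + y * I)) - I * (∫ y : ℝ in c..d, f (a + y * I)) = 0 := by
  have h := Complex.integral_boundary_rect_eq_zero_of_differentiableOn f (a + c * I) (b + d * I)
    (by simpa using H)
  simpa using h

/-- The shifted integrand `Ψ(s) = ½ ψ(s/2) k̂(s)` is holomorphic on `Re s > 0`. [folklore] -/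
theorem differentiableOn_digamma_half_mul_weilMellin {k : ℝ → ℂ} (hk : IsWeilTest k) :
    DifferentiableOn ℂ (fun s : ℂ ↦ 1 / 2 * digamma (s / 2) * weilMellin k s) {s : ℂ | 0 < s.re} := by
  refine DifferentiableOn.mul (DifferentiableOn.mul (differentiableOn_const _) ?_)
    (differentiable_weilMellin hk.1.continuous hk.2).differentiableOn
  exact Literature.Analysis.SpecialFunctions.Complex.differentiableOn_digamma.comp (differentiableOn_id.div_const 2)
    fun s hs ↦ by simp only [mem_setOf_eq, div_ofNat_re] at hs ⊢; positivity

/-- `ψ(w)` on `|Im w| ≥ 1/2`, `0 < Re w`, `‖w‖ ≤ T + 3`: `‖ψ(w)‖ ≤ log(T + 4) + 8`. [folklore] -/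
theorem norm_digamma_le_log_height {w : ℂ} {T : ℝ} (hw : 0 < w.re) (hwim : 1 / 2 ≤ |w.im|)
    (hwn : ‖w‖ ≤ T + 3) : ‖digamma w‖ ≤ Real.log (T + 4) + 8 := by
  have h := Literature.Analysis.SpecialFunctions.Complex.norm_digamma_le_log hw hwim
  have : Real.log (1 + ‖w‖) ≤ Real.log (T + 4) := Real.log_le_log (by positivity) (by linarith)
  linarith

/-- Horizontal sides of the shift: for `T ≥ 1` and `x ∈ [1/2, 3/2]`,
`‖Ψ(x ± iT)‖ ≤ ½ (log(T+4) + 8) · D_k/(1+T²)`. [folklore] -/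
theorem norm_digamma_half_mul_weilMellin_le {k : ℝ → ℂ} (hk : IsWeilTest k) {T : ℝ} (hT : 1 ≤ |T|)
    {x : ℝ} (hx : x ∈ Icc (1 / 2 : ℝ) (3 / 2)) :
    ‖1 / 2 * digamma (((x : ℂ) + T * I) / 2) * weilMellin k (x + T * I)‖ ≤
      1 / 2 * (Real.log (|T| + 4) + 8) * (weilDecayW 1 k / (1 + T ^ 2)) := by
  set w : ℂ := ((x : ℂ) + T * I) / 2 with hw
  have hwre : 0 < w.re := by simp [hw]; linarith [hx.1]
  have hwim : 1 / 2 ≤ |w.im| := by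
    have : w.im = T / 2 := by simp [hw]
    rw [this, abs_div, abs_two]; linarith
  have hwn : ‖w‖ ≤ |T| + 3 := by
    have h1 : ‖(x : ℂ) + T * I‖ ≤ |x| + |T| := (norm_add_le _ _).trans (by simp)
    have h2 : ‖w‖ = ‖(x : ℂ) + T * I‖ / 2 := by simp [hw]
    have hx' : |x| ≤ 3 / 2 := abs_le.2 ⟨by linarith [hx.1], hx.2⟩
    rw [h2]; linarith [norm_nonneg ((x : ℂ) + T * I), abs_nonneg T]
  have hψ := norm_digamma_le_log_height hwre hwim hwn
  have hk' : ‖weilMellin k (x + T * I)‖ ≤ weilDecayW 1 k / (1 + T ^ 2) := by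
    have := norm_weilMellin_le_of_abs_re_le hk (A := 1) (s := x + T * I)
      (by simp; exact abs_le.2 ⟨by linarith [hx.1], by linarith [hx.2]⟩)
    simpa using this
  rw [norm_mul, norm_mul]
  have : ‖(1 / 2 : ℂ)‖ = 1 / 2 := by simp
  rw [this]
  gcongr
  · exact mul_nonneg (by norm_num) (by linarith [norm_nonneg (digamma w)])

/-- The horizontal sides of the shift tend to `0`. [folklore] -/
theorem tendsto_horizontal_digamma_half_mul_weilMellin {k : ℝ → ℂ} (hk : IsWeilTest k) {e : ℝ}
    (he : e = 1 ∨ e = -1) :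
    Tendsto (fun T : ℝ ↦ ∫ x : ℝ in (1 / 2 : ℝ)..(3 / 2),
      1 / 2 * digamma (((x : ℂ) + (e * T : ℝ) * I) / 2) * weilMellin k (x + (e * T : ℝ) * I))
      atTop (𝓝 0) := by
  set D := weilDecayW 1 k with hD
  have hD0 : 0 ≤ D := weilDecayW_nonneg _ _
  have habs : ∀ T : ℝ, |e * T| = |T| := by
    rcases he with rfl | rfl <;> intro T <;> simp
  rw [tendsto_zero_iff_norm_tendsto_zero]
  refine squeeze_zero' (g := fun T : ℝ ↦ 13 / 2 * D * T⁻¹) (Eventually.of_forall fun _ ↦ norm_nonneg _)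
    ((eventually_ge_atTop (1 : ℝ)).mono fun T hT ↦ ?_) ?_
  · -- the bound `(1/2)(log(T+4)+8) D/(1+T²) · 1 ≤ 13 D / T`
    have hT' : 1 ≤ |e * T| := by rw [habs, abs_of_pos (by linarith)]; exact hT
    have h := intervalIntegral.norm_integral_le_of_norm_le_const (a := (1 / 2 : ℝ)) (b := 3 / 2)
      (C := 1 / 2 * (Real.log (|e * T| + 4) + 8) * (D / (1 + (e * T) ^ 2)))
      (f := fun x : ℝ ↦ 1 / 2 * digamma (((x : ℂ) + (e * T : ℝ) * I) / 2) *
        weilMellin k (x + (e * T : ℝ) * I)) fun x hx ↦ by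
        have hx' : x ∈ Icc (1 / 2 : ℝ) (3 / 2) := by
          rw [uIoc_of_le (by norm_num)] at hx; exact ⟨hx.1.le, hx.2⟩
        exact norm_digamma_half_mul_weilMellin_le hk hT' hx'
    refine h.trans ?_
    rw [habs, abs_of_pos (by linarith : (0 : ℝ) < T), show |(3 : ℝ) / 2 - 1 / 2| = 1 by norm_num,
      mul_one, show (e * T) ^ 2 = T ^ 2 by rcases he with rfl | rfl <;> ring]
    have hlog : Real.log (T + 4) ≤ T + 4 := (Real.log_le_sub_one_of_pos (by linarith)).trans (by linarith)
    have h1 : 1 / 2 * (Real.log (T + 4) + 8) ≤ 13 / 2 * T := by nlinarith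
    have h2 : D / (1 + T ^ 2) ≤ D / T ^ 2 := div_le_div_of_nonneg_left hD0 (by positivity) (by linarith)
    calc 1 / 2 * (Real.log (T + 4) + 8) * (D / (1 + T ^ 2))
        ≤ 13 / 2 * T * (D / T ^ 2) := mul_le_mul h1 h2 (by positivity) (by positivity)
      _ = 13 / 2 * D * T⁻¹ := by field_simp
  · have := (tendsto_inv_atTop_zero (𝕜 := ℝ)).const_mul (13 / 2 * D)
    simpa using this

/-- Integrability of `y ↦ ½ψ((c+iy)/2) ĥ(c+iy)` on a line `Re s = c > 0`, and of its reflection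
`y ↦ ½ψ((c−iy)/2) ĥ(c+iy)`. [folklore] -/
theorem integrable_digamma_half_mul_weilMellin_vertical {h : ℝ → ℂ} (hh : IsWeilTest h) {c : ℝ}
    (hc : 0 < c) (e : ℝ) (he : e = 1 ∨ e = -1) :
    Integrable fun y : ℝ ↦ 1 / 2 * digamma (((c : ℂ) + (e * y : ℝ) * I) / 2) * weilMellin h (c + y * I) := by
  obtain ⟨C, hC⟩ := Literature.Analysis.SpecialFunctions.Complex.exists_norm_digamma_vertical_le (a := c / 2) (by positivity)
  have habs : ∀ y : ℝ, |e * y| = |y| := by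
    rcases he with rfl | rfl <;> intro y <;> simp
  refine integrable_mul_weilMellin_vertical_of_norm_le_log hh c ?_ (C := |C|) fun y ↦ ?_
  · refine continuous_const.mul (Literature.Analysis.SpecialFunctions.Complex.continuousOn_digamma.comp_continuous (by fun_prop)
      fun y ↦ ?_)
    simp only [mem_setOf_eq, div_ofNat_re]
    simp; positivity
  · have hw : ((c : ℂ) + (e * y : ℝ) * I) / 2 = ((c / 2 : ℝ) : ℂ) + ((e * y / 2 : ℝ) : ℂ) * I := by
      push_cast; ring
    rw [norm_mul, hw]
    have h1 := hC (e * y / 2)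
    have h2 : Real.log (1 + |e * y / 2|) ≤ Real.log (1 + |y|) := by
      refine Real.log_le_log (by positivity) ?_
      rw [abs_div, habs, abs_two]; linarith [abs_nonneg y]
    have h3 : ‖(1 / 2 : ℂ)‖ = 1 / 2 := by simp
    rw [h3]
    have h0 : 0 ≤ Real.log (1 + |y|) := Real.log_nonneg (by linarith [abs_nonneg y])
    nlinarith [le_abs_self C, norm_nonneg (digamma (((c / 2 : ℝ) : ℂ) + ((e * y / 2 : ℝ) : ℂ) * I))]

/-- **The line of the Gamma term can be shifted**: for a test function `k`,
`∫ ½ψ((3/2+iy)/2) k̂(3/2+iy) dy = ∫ ½ψ((1/2+iy)/2) k̂(1/2+iy) dy` (Cauchy's theorem on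
`[1/2, 3/2] × [−T, T]`, no poles of `ψ(s/2)` in `Re s > 0`, horizontal sides `→ 0`).
[cite: Bombieri2000Weil, §2] -/
theorem integral_digamma_half_mul_weilMellin_shift {k : ℝ → ℂ} (hk : IsWeilTest k) :
    ∫ y : ℝ, 1 / 2 * digamma ((((3 / 2 : ℝ) : ℂ) + y * I) / 2) * weilMellin k (((3 / 2 : ℝ) : ℂ) + y * I) =
      ∫ y : ℝ, 1 / 2 * digamma ((((1 / 2 : ℝ) : ℂ) + y * I) / 2) * weilMellin k (((1 / 2 : ℝ) : ℂ) + y * I) := by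
  set Ψ : ℂ → ℂ := fun s ↦ 1 / 2 * digamma (s / 2) * weilMellin k s with hΨ
  -- Cauchy on `[1/2, 3/2] × [−T, T]`
  have hrect : ∀ T : ℝ, (∫ x : ℝ in (1 / 2 : ℝ)..(3 / 2), Ψ (x + (-T : ℝ) * I)) -
      (∫ x : ℝ in (1 / 2 : ℝ)..(3 / 2), Ψ (x + (T : ℝ) * I)) +
      I * (∫ y : ℝ in (-T)..T, Ψ ((3 / 2 : ℝ) + y * I)) -
      I * (∫ y : ℝ in (-T)..T, Ψ ((1 / 2 : ℝ) + y * I)) = 0 := by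
    intro T
    have := integral_boundary_rect_eq_zero' Ψ (a := 1 / 2) (b := 3 / 2) (c := -T) (d := T)
      ((differentiableOn_digamma_half_mul_weilMellin hk).mono fun s hs ↦ by
        have h1 := hs.1
        rw [uIcc_of_le (by norm_num : (1 / 2 : ℝ) ≤ 3 / 2)] at h1
        simp only [mem_setOf_eq]
        linarith [h1.1])
    simpa using this
  -- limits of the four sides
  have hbot : Tendsto (fun T : ℝ ↦ ∫ x : ℝ in (1 / 2 : ℝ)..(3 / 2), Ψ (x + (-T : ℝ) * I)) atTop (𝓝 0) := by
    have := tendsto_horizontal_digamma_half_mul_weilMellin hk (e := -1) (Or.inr rfl)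
    refine this.congr fun T ↦ ?_
    simp [hΨ]
  have htop : Tendsto (fun T : ℝ ↦ ∫ x : ℝ in (1 / 2 : ℝ)..(3 / 2), Ψ (x + (T : ℝ) * I)) atTop (𝓝 0) := by
    have := tendsto_horizontal_digamma_half_mul_weilMellin hk (e := 1) (Or.inl rfl)
    refine this.congr fun T ↦ ?_
    simp [hΨ]
  have hvert : ∀ c : ℝ, 0 < c → Tendsto (fun T : ℝ ↦ ∫ y : ℝ in (-T)..T, Ψ (c + y * I)) atTop
      (𝓝 (∫ y : ℝ, Ψ (c + y * I))) := by
    intro c hc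
    have hint : Integrable fun y : ℝ ↦ Ψ (c + y * I) := by
      have := integrable_digamma_half_mul_weilMellin_vertical hk hc 1 (Or.inl rfl)
      refine this.congr (Eventually.of_forall fun y ↦ ?_)
      simp [hΨ]
    exact intervalIntegral_tendsto_integral hint tendsto_neg_atTop_atBot tendsto_id
  have hlim : Tendsto (fun T : ℝ ↦ (∫ x : ℝ in (1 / 2 : ℝ)..(3 / 2), Ψ (x + (-T : ℝ) * I)) -
      (∫ x : ℝ in (1 / 2 : ℝ)..(3 / 2), Ψ (x + (T : ℝ) * I)) +
      I * (∫ y : ℝ in (-T)..T, Ψ ((3 / 2 : ℝ) + y * I)) -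
      I * (∫ y : ℝ in (-T)..T, Ψ ((1 / 2 : ℝ) + y * I))) atTop
      (𝓝 (0 - 0 + I * (∫ y : ℝ, Ψ ((3 / 2 : ℝ) + y * I)) - I * (∫ y : ℝ, Ψ ((1 / 2 : ℝ) + y * I)))) :=
    ((hbot.sub htop).add ((hvert _ (by norm_num)).const_mul I)).sub ((hvert _ (by norm_num)).const_mul I)
  have h0 : (0 : ℂ) - 0 + I * (∫ y : ℝ, Ψ ((3 / 2 : ℝ) + y * I)) - I * (∫ y : ℝ, Ψ ((1 / 2 : ℝ) + y * I)) = 0 :=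
    tendsto_nhds_unique hlim (by simp_rw [hrect]; exact tendsto_const_nhds)
  have : (∫ y : ℝ, Ψ ((3 / 2 : ℝ) + y * I)) = ∫ y : ℝ, Ψ ((1 / 2 : ℝ) + y * I) := by
    have h1 : I * ((∫ y : ℝ, Ψ ((3 / 2 : ℝ) + y * I)) - ∫ y : ℝ, Ψ ((1 / 2 : ℝ) + y * I)) = 0 := by
      rw [mul_sub]; simpa using h0
    exact sub_eq_zero.1 ((mul_eq_zero.1 h1).resolve_left I_ne_zero)
  simpa [hΨ] using this

/-- **The Gamma term equals the archimedean integral**: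
`∫ ½ψ((3/2+iy)/2) k̂(3/2+iy) dy = ∫ ĝ(1/2+it) Re ψ(1/4 + it/2) dt = weilArchIntegral g`
(shift to `Re s = 1/2`, `k̂(1/2+iy) = ĝ(1/2+iy) + ĝ(1/2−iy)`, `y ↦ −y`, and
`½(ψ(w) + ψ(w̄)) = Re ψ(w)`; Bombieri §2: "the Gamma factor contributes the archimedean term").
[cite: Bombieri2000Weil, §2] -/
theorem integral_digamma_mul_weilMellin_weilSymm (hg : IsWeilTest g) :
    ∫ y : ℝ, 1 / 2 * digamma ((((3 / 2 : ℝ) : ℂ) + y * I) / 2) *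
        weilMellin (weilSymm g) (((3 / 2 : ℝ) : ℂ) + y * I) = weilArchIntegral g := by
  have hk : IsWeilTest (weilSymm g) := hg.weilSymm
  rw [integral_digamma_half_mul_weilMellin_shift hk]
  set c : ℝ := 1 / 2 with hc
  -- split `k̂(1/2+iy) = ĝ(1/2+iy) + ĝ(1/2-iy)`
  have hrefl : ∀ y : ℝ, 1 - ((c : ℂ) + y * I) = (c : ℂ) + ((-y : ℝ) : ℂ) * I := by
    intro y; simp only [hc]; push_cast; ring
  set A : ℝ → ℂ := fun y ↦ 1 / 2 * digamma (((c : ℂ) + y * I) / 2) * weilMellin g (c + y * I) with hA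
  set B : ℝ → ℂ := fun y ↦ 1 / 2 * digamma (((c : ℂ) + ((-y : ℝ) : ℂ) * I) / 2) * weilMellin g (c + y * I)
    with hB
  have hAi : Integrable A := by
    have := integrable_digamma_half_mul_weilMellin_vertical hg (c := c) (by norm_num) 1 (Or.inl rfl)
    refine this.congr (Eventually.of_forall fun y ↦ ?_); simp [hA]
  have hBi : Integrable B := by
    have := integrable_digamma_half_mul_weilMellin_vertical hg (c := c) (by norm_num) (-1) (Or.inr rfl)
    refine this.congr (Eventually.of_forall fun y ↦ ?_); simp [hB]
  have hsplit : (fun y : ℝ ↦ 1 / 2 * digamma (((c : ℂ) + y * I) / 2) * weilMellin (weilSymm g) (c + y * I)) =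
      fun y : ℝ ↦ A y + B (-y) := by
    funext y
    rw [weilMellin_weilSymm hg, hrefl y]
    simp only [hA, hB, neg_neg]
    push_cast
    ring
  rw [hsplit, integral_add hAi hBi.comp_neg, integral_neg_eq_self B volume, ← integral_add hAi hBi]
  -- combine `½ψ(w) + ½ψ(w̄) = Re ψ(w)`
  unfold weilArchIntegral
  congr 1 with y
  have hw : ((c : ℂ) + ((-y : ℝ) : ℂ) * I) / 2 = conj (((c : ℂ) + y * I) / 2) := by
    simp only [map_div₀, map_add, map_mul, Complex.conj_ofReal, Complex.conj_I, map_ofNat]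
    push_cast
    ring
  have hw' : ((c : ℂ) + y * I) / 2 = 1 / 4 + y / 2 * I := by
    simp only [hc]; push_cast; ring
  have hs' : (c : ℂ) + y * I = 1 / 2 + y * I := by
    simp only [hc]; push_cast; ring
  simp only [hA, hB]
  have hψ : ∀ w : ℂ, digamma w + digamma (conj w) = 2 * ((digamma w).re : ℂ) := fun w ↦ by
    rw [Literature.NumberTheory.LFunctions.digamma_conj, Complex.add_conj]; push_cast; ring
  rw [hw, ← add_mul, ← mul_add, hψ, hw', hs']
  ring

/-! ### Assembly of the right edge -/

/-- **Integrability of `(ξ'/ξ)(3/2 + iy) ĥ(3/2 + iy)`** for every test function `h`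
(`|ξ'/ξ| ≤ C + log(1+|y|)` on the line, `|ĥ| ≤ D/(1+y²)²`). [folklore] -/
theorem integrable_logDeriv_riemannXi_mul_weilMellin {h : ℝ → ℂ} (hh : IsWeilTest h) :
    Integrable fun y : ℝ ↦ logDeriv riemannXi (((3 / 2 : ℝ) : ℂ) + y * I) *
      weilMellin h (((3 / 2 : ℝ) : ℂ) + y * I) := by
  obtain ⟨C, hC⟩ := exists_norm_logDeriv_riemannXi_vertical_le
  exact integrable_mul_weilMellin_vertical_of_norm_le_log hh (3 / 2)
    (continuous_logDeriv_riemannXi_vertical (by norm_num)) hC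

/-- **The right edge of the contour evaluates to `2π W(g)`** (Bombieri 2000, §2, (2.2)–(2.4) and
the line shift of the Gamma term): for every test function `g`,
`∫ (ξ'/ξ)(3/2 + iy) k̂(3/2 + iy) dy = 2π · weilFunctional g`, `k = g + g(−·)`.
[cite: Bombieri2000Weil, §2 eq. (2.2)–(2.4)] -/
theorem integral_logDeriv_riemannXi_mul_weilMellin_weilSymm (hg : IsWeilTest g) :
    ∫ y : ℝ, logDeriv riemannXi (((3 / 2 : ℝ) : ℂ) + y * I) *
        weilMellin (weilSymm g) (((3 / 2 : ℝ) : ℂ) + y * I) = 2 * π * weilFunctional g := by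
  have hk : IsWeilTest (weilSymm g) := hg.weilSymm
  set c : ℝ := 3 / 2 with hc
  -- the four pieces
  set P : ℝ → ℂ := fun y ↦ (1 / ((c : ℂ) + y * I) + 1 / ((c : ℂ) + y * I - 1)) *
    weilMellin (weilSymm g) (c + y * I) with hP
  set Lπ : ℝ → ℂ := fun y ↦ (-(Real.log π : ℂ) / 2) * weilMellin (weilSymm g) (c + y * I) with hLπ
  set G : ℝ → ℂ := fun y ↦ 1 / 2 * digamma (((c : ℂ) + y * I) / 2) * weilMellin (weilSymm g) (c + y * I)
    with hG
  set Z : ℝ → ℂ := fun y ↦ L ↗Λ ((c : ℂ) + y * I) * weilMellin (weilSymm g) (c + y * I) with hZ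
  set Φ : ℝ → ℂ := fun y ↦ logDeriv riemannXi ((c : ℂ) + y * I) * weilMellin (weilSymm g) (c + y * I)
    with hΦ
  have hdecomp : Φ = fun y ↦ P y + Lπ y + G y - Z y := by
    funext y
    simp only [hΦ, hP, hLπ, hG, hZ]
    rw [logDeriv_riemannXi_eq_of_one_lt_re (by simp [hc]; norm_num)]
    ring
  -- integrability
  have hΦi : Integrable Φ := integrable_logDeriv_riemannXi_mul_weilMellin hk
  have hPi : Integrable P := by
    have i0 := integrable_weilMellin_vertical_div_sub hk (c := c) (a := 0) (by norm_num [hc])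
    have i1 := integrable_weilMellin_vertical_div_sub hk (c := c) (a := 1) (by norm_num [hc])
    refine (i0.add i1).congr (Eventually.of_forall fun y ↦ ?_)
    simp only [hP, Pi.add_apply, sub_zero]
    ring
  have hLπi : Integrable Lπ := (integrable_weilMellin_vertical hk c).const_mul _
  have hGi : Integrable G := by
    have := integrable_digamma_half_mul_weilMellin_vertical hk (c := c) (by norm_num) 1 (Or.inl rfl)
    refine this.congr (Eventually.of_forall fun y ↦ ?_)
    simp [hG]
  have hZi : Integrable Z := by
    have : Z = fun y ↦ P y + Lπ y + G y - Φ y := by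
      funext y; rw [hdecomp]; ring
    rw [this]
    exact ((hPi.add hLπi).add hGi).sub hΦi
  -- the four evaluations
  have eP : (∫ y, P y) = 2 * π * weilPolarTerm g := integral_polar_mul_weilMellin_weilSymm hg
  have eL : (∫ y, Lπ y) = -(Real.log π : ℂ) / 2 * (2 * π * (2 * g 0)) :=
    integral_const_mul_weilMellin_weilSymm hg _ c
  have eG : (∫ y, G y) = weilArchIntegral g := integral_digamma_mul_weilMellin_weilSymm hg
  have eZ : (∫ y, Z y) = 2 * π * weilPrimeTerm g := integral_LSeries_mul_weilMellin_weilSymm hg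
  have hPL : Integrable (fun y ↦ P y + Lπ y) := hPi.add hLπi
  have hPLG : Integrable (fun y ↦ P y + Lπ y + G y) := hPL.add hGi
  change (∫ y, Φ y) = _
  rw [hdecomp, integral_sub hPLG hZi, integral_add hPL hGi, integral_add hPi hLπi, eP, eL, eG, eZ]
  simp only [weilFunctional, weilArchTerm]
  have hπ : (π : ℂ) ≠ 0 := ofReal_ne_zero.2 Real.pi_ne_zero
  field_simp
  ring

end Literature.NumberTheory.LFunctions

end
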